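import Summits.QuantumFields.YangMills.Theorems.LuscherReductionTwistedTraceScalingCombWraps
import Summits.QuantumFields.YangMills.Theorems.LuscherReductionTwistedTraceScalingToronOrbit
import Summits.QuantumFields.YangMills.Theorems.LuscherReductionRunningReductionAxialConst
import Summits.QuantumFields.YangMills.Theorems.LuscherReductionRunningReductionTraceFormulaAveraging
import HarnessLib

/-!
# The COMB-FLAT configurations: `treeFix U` is `O(L²)√(2S)`-close to one, and the comb gauge of a flat abelian background IS one
# (lane A of S-BASE, crux `TwistedTraceScaling` stmt-QuantumFields-20203; layer 4a of the comb propagation behind `ValleyLinkProxAt`, design note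
# `pub/ym-fleet/ym-luscher-20007-p1/COARSE-DESIGN.md` §16)

* `combFlat h` — the configuration with every link `1` except the WRAP links (`x_k = −1` in direction `k`), which carry `h k`;
* ★★ `fd_treeFix_combFlat_le` — for EVERY link `e`, `‖treeFix U e − combFlat (wrapReps U) e‖_F ≤ (L−1)(6L−4)·√(2S(U))` with the representatives
  `wrapReps U = (V((−1,0,0),0), V((0,−1,0),1), V((0,0,−1),2))` of `…CombWraps` (layers 2–3 summarised);
* ★★ `treeFix_abelianCfg` — `treeFix (abelianCfg L θ) = combFlat (fun k => diagSU2 (L·θ_k))`: the comb gauge of the flat background `V_θ` is comb-flat with diagonal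
  wraps (from `treeFix_constLift`, `…AxialConst`); hence ★ `combFlat_diag_eq_gaugeTransform_abelianCfg`: `combFlat (diagSU2 ∘ (L·θ)) = g·V_θ` with
  `g = treeGauge V_θ`, and conversely every comb-flat configuration with DIAGONAL wraps `diagSU2 φ_k` is a gauge copy of `abelianCfg (φ/L)`.
Remaining for `ValleyLinkProxAt` (layer 4b): rotate a common-axis commuting triple onto the diagonal torus (constant gauge), and the bookkeeping `U = (Ad W)·(g·V_θ)`.
HONEST FRAMING: bookkeeping on the discrete torus for a stub lane of a child of the CONDITIONAL reduction route (femto rung R2b1); not a gap, not Clay.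
-/

set_option autoImplicit false

noncomputable section

open Matrix Real
open scoped Matrix BigOperators
open Literature.MathematicalPhysics.QuantumFieldTheory
open Literature.MathematicalPhysics.QuantumLattice

namespace Summit.QuantumFields.YangMills.Theorems.FemtoTransferGap.TwoLattice.Flat

open Summit.QuantumFields.YangMills.Theorems.FemtoTransferGap
open Summit.QuantumFields.YangMills.Theorems.FemtoTransferGap.TwoLattice
open Summit.QuantumFields.YangMills.Theorems.FemtoTransferGap.TwoLattice.Toron

variable {L : ℕ} [NeZero L]

/-! ## §1 Comb-flat configurations -/

/-- **Comb-flat configuration** with wrap values `h`: the link `(x, k)` is `h k` if `x_k = −1` (a wrap link) and `1` otherwise. [cite: SeilerLNP1982, §2] -/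
def combFlat (h : Fin 3 → SU2) : GaugeConfig 3 L SU2 := fun e => if e.1 e.2 = -1 then h e.2 else 1

omit [NeZero L] in
/-- Links of `combFlat`. [folklore] -/
theorem combFlat_apply (h : Fin 3 → SU2) (e : Edge 3 L) : combFlat h e = if e.1 e.2 = -1 then h e.2 else 1 := rfl

/-- **The three wrap representatives** of `treeFix U`: `h₀ = V((−1,0,0),0)`, `h₁ = V((0,−1,0),1)`, `h₂ = V((0,0,−1),2)`. [folklore] -/
def wrapReps (U : GaugeConfig 3 L SU2) : Fin 3 → SU2 :=
  ![treeFix U (mk3 (-1) 0 0, 0), treeFix U (mk3 0 (-1) 0, 1), treeFix U (mk3 0 0 (-1), 2)]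

/-- ★★ **`treeFix U` is comb-flat up to `(L−1)(6L−4)√(2S(U))` on every link.** [cite: Luscher1983, §2] -/
theorem fd_treeFix_combFlat_le (U : GaugeConfig 3 L SU2) (e : Edge 3 L) :
    fd (treeFix U e) (combFlat (wrapReps U) e) ≤ ((L : ℝ) - 1) * ((6 * (L : ℝ) - 4) * Real.sqrt (2 * wilsonAction su2Rep U)) := by
  obtain ⟨z, k⟩ := e
  set s := Real.sqrt (2 * wilsonAction su2Rep U) with hsdef
  set B := ((L : ℝ) - 1) * ((6 * (L : ℝ) - 4) * s) with hB
  have hL : (1 : ℝ) ≤ L := by exact_mod_cast NeZero.one_le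
  have hs : 0 ≤ s := Real.sqrt_nonneg _
  have hL0 : 0 ≤ (L : ℝ) - 1 := by linarith
  have hB0 : 0 ≤ B := by rw [hB]; exact mul_nonneg hL0 (mul_nonneg (by linarith) hs)
  have hB1 : 2 * ((L : ℝ) - 1) * s ≤ B := by rw [hB]; nlinarith [mul_nonneg hL0 hs]
  have hB2 : ((L : ℝ) - 1) * ((4 * (L : ℝ) - 2) * s) ≤ B := by rw [hB]; nlinarith [mul_nonneg hL0 hs]
  have hB3 : ((L : ℝ) - 1) * s ≤ B := by rw [hB]; nlinarith [mul_nonneg hL0 hs]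
  rw [combFlat_apply]
  by_cases hz : z k = -1
  · rw [if_pos hz]
    match k, hz with
    | ⟨0, _⟩, hz => exact (fd_treeFix_wrap0_h0_le U hz).trans hB1
    | ⟨1, _⟩, hz => exact (fd_treeFix_wrap1_h1_le U hz).trans hB2
    | ⟨2, _⟩, hz => exact fd_treeFix_wrap2_h2_le U hz
  · rw [if_neg hz]
    match k, hz with
    | ⟨0, _⟩, hz => exact (fd_treeFix_zero_le U hz).trans hB1
    | ⟨1, _⟩, hz => exact (fd_treeFix_one_le U hz).trans hB3
    | ⟨2, _⟩, hz => exact (le_of_eq (fd_treeFix_two_le U hz)).trans hB0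

/-! ## §2 The comb gauge of a flat abelian background -/

omit [NeZero L] in
/-- Powers of diagonal elements: `(diagSU2 a)^n = diagSU2 (n·a)`. [folklore] -/
theorem diagSU2_pow (a : ℝ) (n : ℕ) : diagSU2 a ^ n = diagSU2 (n * a) := by
  induction n with
  | zero => rw [pow_zero, Nat.cast_zero, zero_mul, diagSU2_zero]
  | succ n ih => rw [pow_succ, ih, ← diagSU2_add]; push_cast; ring_nf

omit [NeZero L] in
/-- `abelianCfg` is the constant lift of the one-site diagonal configuration. [folklore] -/
theorem abelianCfg_eq_constLift (θ : Fin 3 → ℝ) : abelianCfg L θ = constLift L (fun e : Edge 3 1 => diagSU2 (θ e.2)) := by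
  funext e; rfl

/-- ★★ **The comb gauge of `V_θ` is comb-flat with diagonal wraps**: `treeFix (abelianCfg L θ) = combFlat (fun k => diagSU2 (L·θ_k))`. [cite: Luscher1983, §2] -/
theorem treeFix_abelianCfg (θ : Fin 3 → ℝ) : treeFix (abelianCfg L θ) = combFlat (fun k => diagSU2 ((L : ℝ) * θ k)) := by
  funext e
  obtain ⟨x, k⟩ := e
  rw [abelianCfg_eq_constLift, treeFix_constLift, combFlat_apply]
  simp only [diagSU2_pow]
  -- everything is `diagSU2` of a real number: collect
  set φ : Site 3 L → ℝ := fun y => ∑ j : Fin 3, ((y j).val : ℝ) * θ j with hφ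
  have hprod : ∀ y : Site 3 L, diagSU2 (((y 0).val : ℕ) * θ 0) * diagSU2 (((y 1).val : ℕ) * θ 1) * diagSU2 (((y 2).val : ℕ) * θ 2) = diagSU2 (φ y) := by
    intro y; rw [← diagSU2_add, ← diagSU2_add, hφ]; simp only [Fin.sum_univ_three]
  rw [hprod, hprod, ← diagSU2_neg, ← diagSU2_add, ← diagSU2_add]
  -- the exponent
  have hshift_ne : ∀ j : Fin 3, j ≠ k → (x.shift k) j = x j := fun j hj => by
    rw [Site.shift, Pi.add_apply, Pi.single_apply, if_neg hj, add_zero]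
  have hshift_k : (x.shift k) k = x k + 1 := by rw [Site.shift, Pi.add_apply, Pi.single_eq_same]
  have hdiff : φ (x.shift k) - φ x = ((((x.shift k) k).val : ℝ) - ((x k).val : ℝ)) * θ k := by
    simp only [hφ]
    rw [← Finset.sum_sub_distrib, Finset.sum_eq_single k]
    · ring
    · intro j _ hj; rw [hshift_ne j hj]; ring
    · intro h; exact absurd (Finset.mem_univ k) h
  have key : φ x + θ k + -φ (x.shift k) = if x k = -1 then (L : ℝ) * θ k else 0 := by
    have e : φ x + θ k + -φ (x.shift k) = θ k - (φ (x.shift k) - φ x) := by ring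
    rw [e, hdiff]
    by_cases hx : x k = -1
    · rw [if_pos hx]
      have hv1 : ((x.shift k) k).val = 0 := by rw [hshift_k, hx, neg_add_cancel, ZMod.val_zero]
      have hv0 : ((x k).val : ℝ) = (L : ℝ) - 1 := by
        have h := zmod_val_neg_one_add_one L
        rw [hx]
        have : ((-1 : ZMod L).val : ℝ) + 1 = L := by exact_mod_cast h
        linarith
      rw [hv1, hv0, Nat.cast_zero]; ring
    · rw [if_neg hx]
      have hv : (((x.shift k) k).val : ℝ) = ((x k).val : ℝ) + 1 := by
        rw [hshift_k, zmod_val_add_one_of_ne hx]; push_cast; ring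
      rw [hv]; ring
  rw [key]
  split_ifs with hx
  · rfl
  · exact diagSU2_zero

/-- ★ **Comb-flat with diagonal wraps is a gauge copy of the flat abelian background**:
`combFlat (fun k => diagSU2 (L·θ_k)) = gaugeTransform (treeGauge (abelianCfg L θ)) (abelianCfg L θ)`. [cite: Luscher1983, §2] -/
theorem combFlat_diag_eq_gaugeTransform_abelianCfg (θ : Fin 3 → ℝ) :
    combFlat (fun k => diagSU2 ((L : ℝ) * θ k)) = gaugeTransform (treeGauge (abelianCfg L θ)) (abelianCfg L θ) := by
  rw [← treeFix_abelianCfg]; rfl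

/-- ★ Conversely, comb-flat with diagonal wraps `diagSU2 φ_k` is a gauge copy of `abelianCfg (φ/L)`. [cite: Luscher1983, §2] -/
theorem combFlat_diag_eq (φ : Fin 3 → ℝ) :
    ∃ g : Site 3 L → SU2, combFlat (fun k => diagSU2 (φ k)) = gaugeTransform g (abelianCfg L (fun k => φ k / L)) := by
  have hL : (L : ℝ) ≠ 0 := by exact_mod_cast NeZero.ne L
  refine ⟨treeGauge (abelianCfg L (fun k => φ k / L)), ?_⟩
  rw [← combFlat_diag_eq_gaugeTransform_abelianCfg]
  congr 1; funext k; rw [mul_div_cancel₀ _ hL]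

end Summit.QuantumFields.YangMills.Theorems.FemtoTransferGap.TwoLattice.Flat

end
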